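import Summits.CriticalPhenomena.PercolationContinuityZ3.Theorems.Transplant.KNLevelsTargetPropertyUniform
import Summits.CriticalPhenomena.PercolationContinuityZ3.Theorems.Transplant.BoxProdZ2TubeLevels
import HarnessLib

/-!
# `X □ ℤ²`: CHAINS OF TARGET STEPS WITH ONE ACCURACY `δ` FOR ALL SUBGRAPHS OF `X □ ℤ²` — in particular for all window tube graphs
# `tubeGraph X π_γ` (the entry anchor `γ` varies with the history; V51 (iii), ENTRY-SEED-STAR.md §1 "one δ for all γ")

builds on p205010 (kernel theorem, internal audit signed; external expert review pending) through `KNLevels.targetPropertyU_KN`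
(`CSH.kozmaNitzan_conjecture3_holds` behind `avoidingGluing_KN`).
Lane `prim-bschramm`, seat `prim-bschramm-stmt` (gen 3; lead g2 V51 (iii): "supply `TargetPropertyU.chain_edge` at `G' := tubeGraph X π_γ` with one
δ as a callable lemma"); helper file (`--supports stmt-CriticalPhenomena-4575`).

The star lemma of the entry-seed scheme (v3′) runs a Kozma–Nitzan Lemma 11/12 chain in the tube graph over the window `B_X(γ, R_w)` of the
examined macro-vertex, possibly cut down to the fresh star; `γ` is history-determined, so infinitely many graphs on the SAME vertex type
`W × Site 2` occur, all subgraphs of `X □ ℤ²`, hence of degree `≤ Δ_X + 4`.  stmt's `KNLevels.TargetPropertyU` (p217247) quantifies `∃ δ` before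
`∀ G`; this file specialises its chain theorems to that family, in the exact shape the instance authors call:
* `targetPropertyU_prod` — `TargetPropertyU (W × Site 2) (Δ + 4) p` for `p < 1` (unconditional);
* **`apply_step_subgraph` / `chain_subgraph` / `chain_edge_subgraph`** — ONE `δ ∈ (0,1]` (given `ε`, `n`) serving EVERY subgraph `G' ≤ X □ ℤ²` (any
  `LocallyFinite` instance), every weighting, every (linked) chain of `TStep G'` with kits at accuracy `δ` (bodies of `TargetProperty.apply_step /
  chain / chain_edge` verbatim);
* **`apply_step_tube` / `chain_tube` / `chain_edge_tube`** — the same for the window tube graphs `tubeGraph X π`, all windows `π : Finset W` at once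
  (p3-g2's `degree_tubeGraph_le`).
[cite: KozmaNitzan2024, §4 Lemma 10 (p. 17), Lemma 11 (p. 22), Lemma 12 (pp. 23–25)] [cite: GrimmettPercolation1999, §7.2]
-/

noncomputable section

open MeasureTheory ProbabilityTheory

namespace Summit.CriticalPhenomena.PercolationContinuityZ3.Theorems

namespace Transplant

namespace BoxProdZ2

open Literature.Probability.Percolation Literature.Probability.LatticeModels SimpleGraph KNLevels

variable {W : Type} [DecidableEq W] [Countable W] (X : SimpleGraph W) [X.LocallyFinite]

/-! ## §1 The uniform target property on the product vertex type -/

omit [X.LocallyFinite] in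
/-- **`TargetPropertyU (W × Site 2) (Δ + 4) p`** for every `p < 1` (unconditional; the degree bound `Δ + 4` is that of `X □ ℤ²` and its subgraphs).
[cite: KozmaNitzan2024, §4 Lemma 10 (p. 17)] -/
theorem targetPropertyU_prod (Δ : ℕ) (p : unitInterval) (hp1 : (p : ℝ) < 1) : TargetPropertyU (W × Site 2) (Δ + 4) p :=
  targetPropertyU_KN p hp1

omit [DecidableEq W] [Countable W] in
/-- Subgraphs of `X □ ℤ²` have degrees `≤ Δ_X + 4` (any `LocallyFinite` instance). [folklore] -/
theorem degree_le_of_subgraph {Δ : ℕ} (hΔ : ∀ w, X.degree w ≤ Δ) (G' : SimpleGraph (W × Site 2)) [G'.LocallyFinite]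
    (hG' : G' ≤ (X □ zdGraph 2)) (v : W × Site 2) : G'.degree v ≤ Δ + 4 := by
  classical
  exact (SimpleGraph.degree_le_of_le hG').trans (ProdKN.degree_prod_le X hΔ v)

/-! ## §2 One `δ` for all subgraphs of `X □ ℤ²` -/

/-- **One application, uniformly over the subgraphs of `X □ ℤ²`.** [cite: KozmaNitzan2024, §4 Lemma 10 (p. 17)] -/
theorem apply_step_subgraph {Δ : ℕ} (hΔ : ∀ w, X.degree w ≤ Δ) (p : unitInterval) (hp1 : (p : ℝ) < 1) {ε : ℝ} (hε : 0 < ε) :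
    ∃ δ : ℝ, 0 < δ ∧ δ ≤ 1 ∧ ∀ (G' : SimpleGraph (W × Site 2)) [G'.LocallyFinite], G' ≤ (X □ zdGraph 2) →
      ∀ (Wt : Sym2 (W × Site 2) → unitInterval) (s : TStep G'), s.KitsAt Wt p (Δ + 4) δ →
      1 - δ < (prodBernoulli Wt).real s.L.reachB → 1 - ε < (prodBernoulli Wt).real (⋃ t ∈ s.T, openConn s.L.o t) := by
  obtain ⟨δ, hδ, hδ1, h⟩ := (targetPropertyU_prod (W := W) Δ p hp1).apply_step hε
  exact ⟨δ, hδ, hδ1, fun G' _ hG' => h G' (degree_le_of_subgraph X hΔ G' hG')⟩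

/-- **Chains, uniformly over the subgraphs of `X □ ℤ²`**: for `ε > 0` and `n` ONE `δ ∈ (0, 1]` such that in EVERY subgraph `G' ≤ X □ ℤ²`, for every
weighting and every linked chain of `n + 1` target steps with kits at accuracy `δ`, `1 − δ < P(o ↔ X_0(0))` gives `1 − ε < P(o ↔ T_n)`.
[cite: KozmaNitzan2024, §4 Lemma 11 (p. 22), Lemma 12 (p. 24)] -/
theorem chain_subgraph {Δ : ℕ} (hΔ : ∀ w, X.degree w ≤ Δ) (p : unitInterval) (hp1 : (p : ℝ) < 1) (n : ℕ) {ε : ℝ} (hε : 0 < ε) :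
    ∃ δ : ℝ, 0 < δ ∧ δ ≤ 1 ∧ ∀ (G' : SimpleGraph (W × Site 2)) [G'.LocallyFinite], G' ≤ (X □ zdGraph 2) →
      ∀ (Wt : Sym2 (W × Site 2) → unitInterval) (s : Fin (n + 1) → TStep G'),
      (∀ i : Fin (n + 1), (s i).L.o = (s 0).L.o) →
      (∀ i : Fin n, (s (Fin.castSucc i)).T ⊆ (s i.succ).L.X 0) →
      (∀ i : Fin (n + 1), (s i).KitsAt Wt p (Δ + 4) δ) →
      1 - δ < (prodBernoulli Wt).real (s 0).L.reachB →
        1 - ε < (prodBernoulli Wt).real (⋃ t ∈ (s (Fin.last n)).T, openConn (s 0).L.o t) := by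
  obtain ⟨δ, hδ, hδ1, h⟩ := (targetPropertyU_prod (W := W) Δ p hp1).chain n hε
  exact ⟨δ, hδ, hδ1, fun G' _ hG' => h G' (degree_le_of_subgraph X hΔ G' hG')⟩

/-- **Chains with enlarged targets, uniformly over the subgraphs of `X □ ℤ²`** (true targets `T'_i ⊆ T_i`, excess `≤ η ≤ δ/2`).
[cite: KozmaNitzan2024, §4 Lemma 11 (p. 22), Lemma 12 (pp. 23–25)] -/
theorem chain_edge_subgraph {Δ : ℕ} (hΔ : ∀ w, X.degree w ≤ Δ) (p : unitInterval) (hp1 : (p : ℝ) < 1) (n : ℕ) {ε : ℝ} (hε : 0 < ε) :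
    ∃ δ : ℝ, 0 < δ ∧ δ ≤ 1 ∧ ∀ (G' : SimpleGraph (W × Site 2)) [G'.LocallyFinite], G' ≤ (X □ zdGraph 2) →
      ∀ (Wt : Sym2 (W × Site 2) → unitInterval) (s : Fin (n + 1) → TStep G') (T' : Fin (n + 1) → Finset (W × Site 2)) (η : ℝ),
      (∀ i : Fin (n + 1), (s i).L.o = (s 0).L.o) →
      (∀ i : Fin n, T' (Fin.castSucc i) ⊆ (s i.succ).L.X 0) →
      (∀ i : Fin (n + 1), T' i ⊆ (s i).T) →
      (∀ i : Fin (n + 1), (s i).KitsAt Wt p (Δ + 4) δ) →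
      η ≤ δ / 2 →
      (∀ i : Fin (n + 1), (prodBernoulli Wt).real (⋃ t ∈ (s i).T \ T' i, openConn (s 0).L.o t) ≤ η) →
      1 - δ < (prodBernoulli Wt).real (s 0).L.reachB →
        1 - ε < (prodBernoulli Wt).real (⋃ t ∈ T' (Fin.last n), openConn (s 0).L.o t) := by
  obtain ⟨δ, hδ, hδ1, h⟩ := (targetPropertyU_prod (W := W) Δ p hp1).chain_edge n hε
  exact ⟨δ, hδ, hδ1, fun G' _ hG' => h G' (degree_le_of_subgraph X hΔ G' hG')⟩

/-! ## §3 One `δ` for all window tube graphs -/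

/-- **One application, uniformly over all windows `π`.** [cite: KozmaNitzan2024, §4 Lemma 10 (p. 17)] -/
theorem apply_step_tube {Δ : ℕ} (hΔ : ∀ w, X.degree w ≤ Δ) (p : unitInterval) (hp1 : (p : ℝ) < 1) {ε : ℝ} (hε : 0 < ε) :
    ∃ δ : ℝ, 0 < δ ∧ δ ≤ 1 ∧ ∀ (π : Finset W) (Wt : Sym2 (W × Site 2) → unitInterval) (s : TStep (tubeGraph X π)),
      s.KitsAt Wt p (Δ + 4) δ → 1 - δ < (prodBernoulli Wt).real s.L.reachB → 1 - ε < (prodBernoulli Wt).real (⋃ t ∈ s.T, openConn s.L.o t) := by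
  obtain ⟨δ, hδ, hδ1, h⟩ := apply_step_subgraph X hΔ p hp1 hε
  exact ⟨δ, hδ, hδ1, fun π => h (tubeGraph X π) (tubeGraph_le X π)⟩

/-- **Chains, uniformly over all windows `π`** (the lemma the star chain calls with `π := B_X(γ, R_w)` for every entry anchor `γ`).
[cite: KozmaNitzan2024, §4 Lemma 11 (p. 22), Lemma 12 (p. 24)] -/
theorem chain_tube {Δ : ℕ} (hΔ : ∀ w, X.degree w ≤ Δ) (p : unitInterval) (hp1 : (p : ℝ) < 1) (n : ℕ) {ε : ℝ} (hε : 0 < ε) :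
    ∃ δ : ℝ, 0 < δ ∧ δ ≤ 1 ∧ ∀ (π : Finset W) (Wt : Sym2 (W × Site 2) → unitInterval) (s : Fin (n + 1) → TStep (tubeGraph X π)),
      (∀ i : Fin (n + 1), (s i).L.o = (s 0).L.o) →
      (∀ i : Fin n, (s (Fin.castSucc i)).T ⊆ (s i.succ).L.X 0) →
      (∀ i : Fin (n + 1), (s i).KitsAt Wt p (Δ + 4) δ) →
      1 - δ < (prodBernoulli Wt).real (s 0).L.reachB →
        1 - ε < (prodBernoulli Wt).real (⋃ t ∈ (s (Fin.last n)).T, openConn (s 0).L.o t) := by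
  obtain ⟨δ, hδ, hδ1, h⟩ := chain_subgraph X hΔ p hp1 n hε
  exact ⟨δ, hδ, hδ1, fun π => h (tubeGraph X π) (tubeGraph_le X π)⟩

/-- **Chains with enlarged targets, uniformly over all windows `π`** (rim faces into the enlarged targets `T_i ⊇ T'_i`, excess `≤ η ≤ δ/2` by the
collar bound from the centre — ENTRY-SEED-STAR.md §1, amendment (B)). [cite: KozmaNitzan2024, §4 Lemma 11 (p. 22), Lemma 12 (pp. 23–25)] -/
theorem chain_edge_tube {Δ : ℕ} (hΔ : ∀ w, X.degree w ≤ Δ) (p : unitInterval) (hp1 : (p : ℝ) < 1) (n : ℕ) {ε : ℝ} (hε : 0 < ε) :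
    ∃ δ : ℝ, 0 < δ ∧ δ ≤ 1 ∧ ∀ (π : Finset W) (Wt : Sym2 (W × Site 2) → unitInterval) (s : Fin (n + 1) → TStep (tubeGraph X π))
      (T' : Fin (n + 1) → Finset (W × Site 2)) (η : ℝ),
      (∀ i : Fin (n + 1), (s i).L.o = (s 0).L.o) →
      (∀ i : Fin n, T' (Fin.castSucc i) ⊆ (s i.succ).L.X 0) →
      (∀ i : Fin (n + 1), T' i ⊆ (s i).T) →
      (∀ i : Fin (n + 1), (s i).KitsAt Wt p (Δ + 4) δ) →
      η ≤ δ / 2 →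
      (∀ i : Fin (n + 1), (prodBernoulli Wt).real (⋃ t ∈ (s i).T \ T' i, openConn (s 0).L.o t) ≤ η) →
      1 - δ < (prodBernoulli Wt).real (s 0).L.reachB →
        1 - ε < (prodBernoulli Wt).real (⋃ t ∈ T' (Fin.last n), openConn (s 0).L.o t) := by
  obtain ⟨δ, hδ, hδ1, h⟩ := chain_edge_subgraph X hΔ p hp1 n hε
  exact ⟨δ, hδ, hδ1, fun π => h (tubeGraph X π) (tubeGraph_le X π)⟩

end BoxProdZ2

end Transplant

end Summit.CriticalPhenomena.PercolationContinuityZ3.Theorems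

end
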